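import Summits.KontsevichZagierPeriods.KontsevichZagierPeriods.Theorems.SoloInformedCornerStep
import Summits.KontsevichZagierPeriods.KontsevichZagierPeriods.Theorems.SoloInformedCornerLeaves
import Summits.KontsevichZagierPeriods.KontsevichZagierPeriods.Theorems.SoloInformedAlgConeCases
import HarnessLib

/-!
# The vertex recursion: every corner configuration is presentable

Solo programme `solo-KontsevichZagierPeriods-informed`, session s111, step (γ-12) of the kernel
project PRES-RAT(2): **THEOREM CORNER** — for every pair `(F, D)` of `K`-polynomials in two
variables (`K` a real-root-closed field of real algebraic numbers) and every corner configuration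
`(F, D, Ω)`, every `P/D` is presentable on `Ω`.

The proof is a well-founded induction on the termination measure
`μ♯(F, D) = (mult₀ F, (ν♯, κ♯))` of file `SoloInformedAnNuPole`.  By the local criterion it
suffices to show local presentability at every point of the closed square: points `≠ 0`, the
smooth corner and the topological corner are leaves (file `SoloInformedCornerLeaves`); otherwise
the corner step (file `SoloInformedCornerStep`) reduces the corner cell to the children, whose
measure is smaller: a non-characteristic apex or a non-pure cone lowers the multiplicity, a pure
cone of order `≥ 2` lowers `ν♯` (file `SoloInformedAnDropCurve`), and a pure cone of order `1`
lowers the polar order `κ♯` (the case `κ♯ = ⊤` being the topological leaf); the swapped child with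
a vertical tangent is measured in the swapped frame, where `μ♯` takes the same value.

References: Kontsevich–Zagier, *Periods* (2001), §1.2; Bierstone–Milman, *Semianalytic and
subanalytic sets*, Publ. IHES 67 (1988), §4.
-/

noncomputable section

open scoped BigOperators Polynomial
open MeasureTheory Set Polynomial
open Literature.NumberTheory.Transcendental Literature.NumberTheory.Transcendental.KZ
open Literature.ModelTheory.ExponentialFields (IsSemialgebraic)

namespace Summit.KontsevichZagierPeriods.KontsevichZagierPeriods.Theorems

variable {K : Type*} [Field K] [Algebra K ℝ]

/-- Along any branch the zero denominator has polar order `κ♯(F, 0) = ⊤`. -/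
theorem soloInformed_kappaDK_zero_eq_top {F : MvPolynomial (Fin 2) K} (H : SoloInformedContactOK F) :
    soloInformedKappaDK F 0 = ⊤ := by
  unfold soloInformedKappaDK
  rw [dif_pos H, analyticOrderAt_eq_top]
  exact Filter.Eventually.of_forall fun x => by simp [soloInformed_evalR_apply]

omit [Algebra K ℝ] in
/-- The top coefficient of a pure cone `c (X - t)^{k+1}` is the pure `x₁^{k+1}` coefficient. -/
theorem soloInformed_topCoeffK_of_pureCone {F : MvPolynomial (Fin 2) K} {k : ℕ}
    (hmult : soloInformedMultK F = k + 1) {c t : K}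
    (hcone : soloInformedConePolyK F (k + 1) = C c * (X - C t) ^ (k + 1)) :
    soloInformedTopCoeffK F = c := by
  unfold soloInformedTopCoeffK
  rw [hmult, ← soloInformed_coeff_conePolyK_self F (soloInformed_le_deg_of_multK_eq hmult), hcone,
    soloInformed_coeff_C_mul_X_sub_C_pow_self]

/-- **The `F`-children have smaller measure.**  Induction transfer to the child pair
`(child_F(t, κ, λ), x₀^{d₁} child_D)` of a germ of multiplicity `k + 1` with finite singular set;
in the pure case of order one the polar order must be finite and a power of `x₀` cancelled.
[this work] -/
theorem soloInformed_cornerOK_childF {F D : MvPolynomial (Fin 2) K} {k : ℕ}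
    (hmult : soloInformedMultK F = k + 1) (hcone0 : soloInformedConePolyK F (k + 1) ≠ 0)
    (hsing : (soloInformedSingSet F).Finite) {c d₁ : ℕ}
    (hd : ∀ a ∈ D.support, c + d₁ ≤ a 0 + a 1)
    (hfin : k = 0 → MvPolynomial.coeff (Finsupp.single 1 1) F ≠ 0 →
      0 < c ∧ soloInformedKappaDK F D ≠ ⊤)
    (ih : ∀ F' D' : MvPolynomial (Fin 2) K, soloInformedMuDK F' D' < soloInformedMuDK F D →
      SoloInformedCornerOK F' D')
    {t κ lam : K} (hκ : algebraMap K ℝ κ ≠ 0) (hlam : algebraMap K ℝ lam ≠ 0) :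
    SoloInformedCornerOK (soloInformedChildK F (k + 1) t κ lam)
      (soloInformedChildDenK D c d₁ t κ lam) := by
  have hm := soloInformed_le_deg_of_multK_eq hmult
  have hlamK : lam ≠ 0 := fun h => hlam (by rw [h, map_zero])
  by_cases hpure : ∃ c' : K, soloInformedConePolyK F (k + 1) = C c' * (X - C t) ^ (k + 1)
  · obtain ⟨c', hc⟩ := hpure
    have hc' : c' ≠ 0 := by
      rintro rfl
      rw [map_zero, zero_mul] at hc
      exact hcone0 hc
    by_cases hmC : soloInformedMultK (soloInformedChildK F (k + 1) t κ lam) = k + 1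
    · rcases Nat.eq_zero_or_pos k with hk | hk
      · subst hk
        obtain ⟨hcpos, hfin'⟩ := hfin rfl (by
          have h1 := soloInformed_topCoeffK_of_pureCone hmult hc
          unfold soloInformedTopCoeffK at h1
          rw [hmult] at h1
          rw [h1]; exact hc')
        exact ih _ _ (soloInformed_muDK_childK_lt_of_multK_one hmult hc' hc hκ hlam hd
          (by omega) hfin')
      · exact ih _ _ (soloInformed_muDK_childK_lt_of_pureCone hk hmult hc' hc
          (by rw [soloInformed_topCoeffK_of_pureCone hmult hc]; exact hc') hsing hκ hlam hmC _ D)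
    · refine ih _ _ (soloInformed_muDK_lt_of_multK_lt ?_ _ D)
      rw [hmult]
      exact lt_of_le_of_ne (soloInformed_multK_childK_le_of_pow hc hc' κ hlamK) hmC
  · push Not at hpure
    refine ih _ _ (soloInformed_muDK_lt_of_multK_lt ?_ _ D)
    rw [hmult]
    exact soloInformed_multK_childK_lt_of_not_pow hm hlamK hpure

/-- **The swapped children with vertical tangent have smaller measure.**  Induction transfer to
the child pair of `(swap F, swap D)` at apex slope `0`; in the pure case `cone_{swap F} = c X^{k+1}`
the cone of `F` is constant, so `μ♯(F, D) = μ♯(swap F, swap D)`. [this work] -/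
theorem soloInformed_cornerOK_childS {F D : MvPolynomial (Fin 2) K} {k : ℕ}
    (hmult : soloInformedMultK F = k + 1) (hcone0 : soloInformedConePolyK F (k + 1) ≠ 0)
    (hsing : (soloInformedSingSet F).Finite) {c d₁ : ℕ}
    (hd : ∀ a ∈ D.support, c + d₁ ≤ a 0 + a 1)
    (hfin : k = 0 → MvPolynomial.coeff (Finsupp.single 0 1) F ≠ 0 →
      0 < c ∧ soloInformedKappaDK (soloInformedSwapK F) (soloInformedSwapK D) ≠ ⊤)
    (ih : ∀ F' D' : MvPolynomial (Fin 2) K, soloInformedMuDK F' D' < soloInformedMuDK F D →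
      SoloInformedCornerOK F' D')
    {κ lam : K} (hκ : algebraMap K ℝ κ ≠ 0) (hlam : algebraMap K ℝ lam ≠ 0) :
    SoloInformedCornerOK (soloInformedChildK (soloInformedSwapK F) (k + 1) 0 κ lam)
      (soloInformedChildDenK (soloInformedSwapK D) c d₁ 0 κ lam) := by
  have hm := soloInformed_le_deg_of_multK_eq hmult
  have hmS := soloInformed_le_deg_swapK hm
  have hmultS : soloInformedMultK (soloInformedSwapK F) = k + 1 := by
    rw [soloInformed_multK_swapK, hmult]
  have hlamK : lam ≠ 0 := fun h => hlam (by rw [h, map_zero])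
  by_cases hpure : ∃ c' : K,
      soloInformedConePolyK (soloInformedSwapK F) (k + 1) = C c' * (X - C 0) ^ (k + 1)
  · obtain ⟨c', hc⟩ := hpure
    have hconeS0 : soloInformedConePolyK (soloInformedSwapK F) (k + 1) ≠ 0 := by
      rw [soloInformed_conePolyK_swapK F hm, Ne, Polynomial.reflect_eq_zero_iff]; exact hcone0
    have hc' : c' ≠ 0 := by
      rintro rfl
      rw [map_zero, zero_mul] at hc
      exact hconeS0 hc
    -- the cone of `F` is the constant `c'`: not a pure power with a non-negative root
    have h₁ : ∀ c₁ t : K, c₁ ≠ 0 → 0 ≤ algebraMap K ℝ t →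
        soloInformedConePolyK F (k + 1) ≠ C c₁ * (X - C t) ^ (k + 1) := by
      intro c₁ t hc₁ _ habs
      have h1 := congrArg (fun p : K[X] => p.coeff (k + 1)) habs
      simp only [soloInformed_coeff_C_mul_X_sub_C_pow_self] at h1
      have h2 : (soloInformedConePolyK F (k + 1)).coeff (k + 1) = 0 := by
        have h3 := soloInformed_conePolyK_swapK (soloInformedSwapK F) hmS
        rw [soloInformed_swapK_swapK] at h3
        rw [h3, Polynomial.coeff_reflect, Polynomial.revAt_le le_rfl, Nat.sub_self, hc, map_zero,
          sub_zero, Polynomial.coeff_C_mul, Polynomial.coeff_X_pow, if_neg (by omega), mul_zero]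
      exact hc₁ (h1 ▸ h2)
    have hμ := soloInformed_muDK_eq_muDK_swapK hmult h₁ hc' (by rw [map_zero]) hc D
    have hsingS : (soloInformedSingSet (soloInformedSwapK F)).Finite := by
      rw [soloInformed_singSet_swapK]
      exact hsing.preimage Prod.swap_injective.injOn
    by_cases hmC : soloInformedMultK (soloInformedChildK (soloInformedSwapK F) (k + 1) 0 κ lam) = k + 1
    · rcases Nat.eq_zero_or_pos k with hk | hk
      · subst hk
        obtain ⟨hcpos, hfin'⟩ := hfin rfl (by
          have h1 := soloInformed_topCoeffK_of_pureCone hmultS hc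
          unfold soloInformedTopCoeffK at h1
          rw [hmultS] at h1
          have h2 := soloInformed_coeff_swapK F 0 1
          rw [Finsupp.single_zero, zero_add, Finsupp.single_zero, add_zero] at h2
          rw [← h2, h1]; exact hc')
        have hlt := soloInformed_muDK_childK_lt_of_multK_one hmultS hc' hc hκ hlam
          (soloInformed_le_deg_swapK hd) (show d₁ < c + d₁ by omega) hfin'
        rw [← hμ] at hlt
        exact ih _ _ hlt
      · have hlt := soloInformed_muDK_childK_lt_of_pureCone hk hmultS hc' hc
          (by rw [soloInformed_topCoeffK_of_pureCone hmultS hc]; exact hc') hsingS hκ hlam hmC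
          (soloInformedChildDenK (soloInformedSwapK D) c d₁ 0 κ lam) (soloInformedSwapK D)
        rw [← hμ] at hlt
        exact ih _ _ hlt
    · refine ih _ _ (soloInformed_muDK_lt_of_multK_lt ?_ _ D)
      rw [hmult]
      exact lt_of_le_of_ne (soloInformed_multK_childK_le_of_pow hc hc' κ hlamK) hmC
  · push Not at hpure
    refine ih _ _ (soloInformed_muDK_lt_of_multK_lt ?_ _ D)
    rw [hmult]
    exact soloInformed_multK_childK_lt_of_not_pow hmS hlamK hpure

/-- `mult₀ D ≥ 1` when `D ≠ 0` vanishes at the corner. -/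
theorem soloInformed_multK_pos_of_aeval_zero {D : MvPolynomial (Fin 2) K} (hD : D ≠ 0)
    (h0 : (MvPolynomial.aeval (0 : Fin 2 → ℝ) D : ℝ) = 0) : 0 < soloInformedMultK D := by
  by_contra h
  exact soloInformed_aevalK_zero_ne_of_multK hD (by omega) h0

section Main

variable [CharZero K]

/-- **THEOREM CORNER (the vertex recursion).**  Over a real-root-closed field of real algebraic
numbers, every corner configuration is presentable: for all `F, D, Ω, P` with `(F, D, Ω)` a
corner configuration, `P/D` is presentable on `Ω`. [this work] -/
theorem soloInformed_cornerOK (hK : ∀ c : K, IsAlgebraic ℚ (algebraMap K ℝ c))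
    (hKrc : SoloInformedRealRootClosed K) (F D : MvPolynomial (Fin 2) K) :
    SoloInformedCornerOK F D := by
  suffices h : ∀ μ : ℕ ×ₗ ((ℕ∞ ×ₗ ℕ∞) ×ₗ ℕ∞), ∀ F D : MvPolynomial (Fin 2) K,
      soloInformedMuDK F D = μ → SoloInformedCornerOK F D from h _ F D rfl
  intro μ
  induction μ using WellFoundedLT.induction with
  | ind μ ihμ =>
    intro F D hμ
    have ih : ∀ F' D' : MvPolynomial (Fin 2) K, soloInformedMuDK F' D' < soloInformedMuDK F D →
        SoloInformedCornerOK F' D' := fun F' D' hlt => ihμ _ (hμ ▸ hlt) F' D' rfl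
    classical
    intro Ω P hcfg
    refine soloInformed_presOn_of_locally hcfg.isSemialgebraic
      (hcfg.subset.trans (soloInformedOpenCube_subset_cube 2)) fun p hp => ?_
    by_cases hp0 : p ≠ 0
    · exact soloInformed_locPresOn_of_cornerCfg_ne_zero hK hKrc hcfg P hp hp0
    push Not at hp0
    subst hp0
    by_cases hcl : (0 : Fin 2 → ℝ) ∉ closure Ω
    · exact soloInformed_locPresOn_of_not_mem_closure hcl
    push Not at hcl
    by_cases hFv : (MvPolynomial.aeval (0 : Fin 2 → ℝ) F : ℝ) ≠ 0
    · exact soloInformed_locPresOn_of_aeval_ne hK hKrc P D F hcfg.isOpen hcfg.subset hcfg.frontier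
        hcl hFv
    push Not at hFv
    have hF0 : F ≠ 0 := by
      rintro rfl
      rw [SoloInformedCornerCfg.eq_empty_of_zero hcfg, closure_empty] at hcl
      exact hcl
    -- multiplicity `k + 1`, cone, numerator and denominator data
    rcases Nat.eq_zero_or_eq_succ_pred (soloInformedMultK F) with hzero | hsucc
    · exact absurd hFv (soloInformed_aevalK_zero_ne_of_multK hF0 hzero)
    set k := (soloInformedMultK F).pred with hk
    have hmult : soloInformedMultK F = k + 1 := hsucc
    have hm := soloInformed_le_deg_of_multK_eq hmult
    obtain ⟨a₀, ha₀, hdeg⟩ := soloInformed_exists_deg_eq_multK hF0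
    rw [hmult] at hdeg
    have hcone0 := soloInformed_conePolyK_ne_zero F hm ha₀ hdeg
    set s := soloInformedMultK P with hs
    have hsP : ∀ a ∈ P.support, s ≤ a 0 + a 1 := soloInformed_le_deg_of_multK_eq rfl
    set d := soloInformedMultK D with hd_def
    have hdD : ∀ a ∈ D.support, d ≤ a 0 + a 1 := soloInformed_le_deg_of_multK_eq rfl
    set c := min d (s + 1) with hc_def
    have hd' : ∀ a ∈ D.support, c + (d - c) ≤ a 0 + a 1 := fun a ha => by
      have h1 := hdD a ha
      have h2 : c ≤ d := min_le_left _ _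
      omega
    have hss : s + 1 = c + (s + 1 - c) := by
      have h2 : c ≤ s + 1 := min_le_right _ _
      omega
    -- the smooth corner
    by_cases hsm : k = 0 ∧ (MvPolynomial.aeval (0 : Fin 2 → ℝ) D : ℝ) ≠ 0
    · obtain ⟨hk0, hD0⟩ := hsm
      rw [hk0, zero_add] at hmult
      exact soloInformed_locPresOn_zero_of_multK_one hK hKrc hcfg P hmult hD0
    -- the topological corner
    by_cases htop : k = 0 ∧
        ((MvPolynomial.coeff (Finsupp.single 1 1) F ≠ 0 ∧ soloInformedKappaDK F D = ⊤) ∨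
          (MvPolynomial.coeff (Finsupp.single 0 1) F ≠ 0 ∧
            soloInformedKappaDK (soloInformedSwapK F) (soloInformedSwapK D) = ⊤))
    · obtain ⟨hk0, h⟩ := htop
      rw [hk0, zero_add] at hmult
      exact soloInformed_locPresOn_zero_of_kappaDK_top hK hKrc hcfg P hmult h
    -- the data for the order-one corner: `D ≠ 0`, `D(0) = 0`, hence `c ≥ 1`
    have hcpos : k = 0 → (MvPolynomial.coeff (Finsupp.single 1 1) F ≠ 0 ∨
        MvPolynomial.coeff (Finsupp.single 0 1) F ≠ 0) → D ≠ 0 → 0 < c := by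
      intro hk0 _ hD
      have hD0 : (MvPolynomial.aeval (0 : Fin 2 → ℝ) D : ℝ) = 0 := by
        by_contra h; exact hsm ⟨hk0, h⟩
      have h1 := soloInformed_multK_pos_of_aeval_zero hD hD0
      change 0 < min d (s + 1)
      exact lt_min h1 (Nat.succ_pos s)
    have hfinF : k = 0 → MvPolynomial.coeff (Finsupp.single 1 1) F ≠ 0 →
        0 < c ∧ soloInformedKappaDK F D ≠ ⊤ := by
      intro hk0 hc1
      have hne : soloInformedKappaDK F D ≠ ⊤ := fun h => htop ⟨hk0, Or.inl ⟨hc1, h⟩⟩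
      refine ⟨hcpos hk0 (Or.inl hc1) ?_, hne⟩
      rintro rfl
      rw [hk0, zero_add] at hmult
      have hmax : soloInformedMaxContactK F = F := by
        rw [soloInformed_maxContactK_eq (k := 0) hmult]; rfl
      exact hne (soloInformed_kappaDK_zero_eq_top (soloInformed_contactOK_of_coeff (by rwa [hmax])))
    have hfinS : k = 0 → MvPolynomial.coeff (Finsupp.single 0 1) F ≠ 0 →
        0 < c ∧ soloInformedKappaDK (soloInformedSwapK F) (soloInformedSwapK D) ≠ ⊤ := by
      intro hk0 hc1
      have hne : soloInformedKappaDK (soloInformedSwapK F) (soloInformedSwapK D) ≠ ⊤ := fun h =>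
        htop ⟨hk0, Or.inr ⟨hc1, h⟩⟩
      refine ⟨hcpos hk0 (Or.inr hc1) ?_, hne⟩
      rintro rfl
      rw [hk0, zero_add] at hmult
      have hmultS : soloInformedMultK (soloInformedSwapK F) = 0 + 1 := by
        rw [soloInformed_multK_swapK, hmult]
      have hmax : soloInformedMaxContactK (soloInformedSwapK F) = soloInformedSwapK F := by
        rw [soloInformed_maxContactK_eq (k := 0) hmultS]; rfl
      have hc1' : MvPolynomial.coeff (Finsupp.single 1 1) (soloInformedSwapK F) ≠ 0 := by
        have h2 := soloInformed_coeff_swapK F 0 1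
        rw [Finsupp.single_zero, zero_add, Finsupp.single_zero, add_zero] at h2
        rwa [h2]
      refine hne ?_
      rw [map_zero]
      exact soloInformed_kappaDK_zero_eq_top (soloInformed_contactOK_of_coeff (by rwa [hmax]))
    -- the corner step
    refine ⟨1, one_pos, fun N j hN _ => ?_⟩
    by_cases hj : ∀ i, (j i : ℕ) = 0
    · refine soloInformed_presOn_cornerCell_of_children hK hKrc hcfg hm hcone0 hd' hsP hss
        (fun t κ lam hκ0 _ hlam _ _ _ _ _ => ?_) (fun κ lam hκ0 _ hlam0 _ _ => ?_) hN hj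
      · exact soloInformed_cornerOK_childF hmult hcone0 hcfg.singFinite hd' hfinF ih hκ0.ne' hlam
      · exact soloInformed_cornerOK_childS hmult hcone0 hcfg.singFinite hd' hfinS ih hκ0.ne'
          hlam0.ne'
    · push Not at hj
      obtain ⟨i, hi⟩ := hj
      have hNr : (0 : ℝ) < N := by exact_mod_cast hN
      refine soloInformed_presOn_inter_gridCell_of_leafCfg hK hKrc P D F hcfg.isOpen
        hcfg.isSemialgebraic hcfg.frontier hN j fun z hz hzcl hFz =>
        hcfg.invB z (soloInformedGridCell_subset_cube j hz) (fun hz0 => ?_) hzcl hFz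
      have h1 := (hz i).1
      rw [hz0, Pi.zero_apply] at h1
      have h2 : (0 : ℝ) < ((j i : ℕ) : ℝ) / N :=
        div_pos (by exact_mod_cast Nat.pos_of_ne_zero hi) hNr
      exact absurd (h2.trans_le h1) (lt_irrefl _)

end Main

end Summit.KontsevichZagierPeriods.KontsevichZagierPeriods.Theorems
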